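import Summits.HodgeConjecture.CorCM.HypLiu418.RecordSystemConjAlongConj
import Summits.HodgeConjecture.HodgeCM.Model.LiuDictionaryPin
import Summits.HodgeConjecture.CorCM.PortJoin.Universe
import Literature.NumberTheory.ComplexMultiplication.CMTypeBasic
import HarnessLib

/-!
# The off-place face in the END's currency: the flipped embedding is at place, the flipped CM type, `V` re-read at `conj ∘ ι₁` (package side)

Cell `hodgecm-mathlib`, fan A — `hLiu418` OFF PLACE (crux `stmt-HodgeConjecture-24832`, registered residual
`stub_bettiThetaModel_offPlace` of `Cruxes/HLiu418/Lines/a3_liu418.lean` v4), END FILE PLAN v1 FILE B (director g2 2026-08-28T04:40:51Z;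
A-p08 lead = FILE A `OffPlaceTowerIso` ∕ FILE D, A-p02 = this file, A-p12 = FILE C).

The END's stubs quantify a face as `(F : HodgeCM.CMField) {ι₁ : F →+* ℂ} (V : HodgeCM.HermSpace3 F ι₁) (a) (Φ : CMType F) (hΦ : ι₁ ∈ Φ.1)`
— PACKAGE currency — and read the CorCM objects through the cast `⟨V.Hm, V.isHermitian, V.signature_ι₁, V.posDef_of_ne⟩ :
Summit.HodgeConjecture.CorCM.HermSpace3 ⟨F.K⟩ ι₁` (= ✔ `PortJoin.HermSpace3.ofPkg V` unfolded).  At an OFF-PLACE face (`hoff : (mk ι₁).embedding ≠ ι₁`) the at-place junction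
✔ `bettiThetaModelAtPlace_of_hyp413_of_pinning` is invoked at the FLIPPED face `(conj ∘ ι₁, V.alongConj, a, Φ̄)`; this file supplies exactly the
three inputs of that invocation and the bookkeeping the Weil side (FILE C) reads:

* §1 `embedding_mk_starRingEnd_comp_of_ne` — off place, `conj ∘ ι₁` IS the chosen embedding of the (common) place: the `hemb` of the flipped face;
  `starRingEnd_comp_mem_bar` — `ι₁ ∈ Φ` forces `conj ∘ ι₁ ∈ Φ̄` (and `conj ∘ ι₁ ∉ Φ`: the CM type MUST be flipped too): the `hΦ` of the flipped face.
* §2 `HodgeCM.HermSpace3.alongConj V : HodgeCM.HermSpace3 F (conj ∘ ι₁)` — the SAME Gram matrix read at the conjugate embedding, PACKAGE side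
  (the face the END quantifies over); its CorCM cast is fieldwise A-p08's `Summit.HodgeConjecture.CorCM.HermSpace3.alongConj` of the cast (FILE A;
  same `Hm`, same signature witness `conjFrame (frameOf _)`), so `rfl` bridges the two once FILE A is in the tree.
* §3 the flipped face reads the SAME rational frame and the SAME pullback hom `ιVE` (`rfl`: both are chosen from `V.Hm` alone) — the carriers of
  the END's uniform Weil family `UV` at the two faces agree on the nose (input of FILE C).

KERNEL: one definition by explicit formula (§2) + `rfl`/two-line lemmas; no named fact, no instance, no notation, no `sorry`.
HC_CM is NOT proved here; HC_CM is proved only modulo the 7 printed citations until rung 0 closes.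

References: [Liu2021] Y. Liu, arXiv:2102.11518, §4.2, Prop. 4.13; [Milne2005ShimuraVarieties] §12 (the datum `(G, X̄)`).
-/

set_option autoImplicit false

noncomputable section

open NumberField
open scoped Matrix ComplexOrder

/-! ## §1 Places and CM types at the flipped embedding -/

namespace Summit.HodgeConjecture.CorCM.OffPlaceFace

open Literature.AlgebraicGeometry.Motives (CMType)
open Literature.NumberTheory.ComplexMultiplication

variable {K : Type} [Field K]

/-- Off place, the chosen embedding of the place of `φ` is `conj ∘ φ` (Mathlib: it is `φ` or its conjugate). [folklore] -/
theorem embedding_mk_eq_starRingEnd_comp_of_ne {φ : K →+* ℂ} (h : (InfinitePlace.mk φ).embedding ≠ φ) :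
    (InfinitePlace.mk φ).embedding = (starRingEnd ℂ).comp φ :=
  (InfinitePlace.embedding_mk_eq φ).resolve_left h

/-- **The flipped face is AT PLACE.**  If `φ` is off place then `conj ∘ φ` is the chosen embedding of ITS place (`mk (conj ∘ φ) = mk φ`):
the hypothesis `hemb` of the at-place junction `bettiThetaModelAtPlace_of_hyp413_of_pinning` at the flipped face. [folklore] -/
theorem embedding_mk_starRingEnd_comp_of_ne {φ : K →+* ℂ} (h : (InfinitePlace.mk φ).embedding ≠ φ) :
    (InfinitePlace.mk ((starRingEnd ℂ).comp φ)).embedding = (starRingEnd ℂ).comp φ :=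
  (congrArg InfinitePlace.embedding (InfinitePlace.mk_conjugate_eq φ)).trans (embedding_mk_eq_starRingEnd_comp_of_ne h)

/-- An off-place embedding is not fixed by conjugation (its place is complex). [folklore] -/
theorem starRingEnd_comp_ne_of_ne {φ : K →+* ℂ} (h : (InfinitePlace.mk φ).embedding ≠ φ) : (starRingEnd ℂ).comp φ ≠ φ :=
  fun h' => h ((embedding_mk_eq_starRingEnd_comp_of_ne h).trans h')

/-- **The CM type must be flipped with the embedding**: `φ ∈ Φ` ⇒ `conj ∘ φ ∉ Φ`. [folklore] -/
theorem starRingEnd_comp_not_mem {Φ : CMType K} {φ : K →+* ℂ} (h : φ ∈ Φ.1) : (starRingEnd ℂ).comp φ ∉ Φ.1 :=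
  (CMTypeOps.mem_iff_conjugate_notMem Φ φ).1 h

/-- … and `conj ∘ φ ∈ Φ̄` (`CMTypeOps.bar Φ`, underlying set `Φᶜ`): the hypothesis `hΦ` of the at-place junction at the flipped face
`(conj ∘ ι₁, Φ̄)`. [folklore] -/
theorem starRingEnd_comp_mem_bar {Φ : CMType K} {φ : K →+* ℂ} (h : φ ∈ Φ.1) : (starRingEnd ℂ).comp φ ∈ (CMTypeOps.bar Φ).1 :=
  (CMTypeOps.mem_bar_iff Φ _).2 (starRingEnd_comp_not_mem h)

/-- The package's conjugate CM type `HodgeCM.CMTypeOps.bar` IS the Literature one (same underlying set `Φᶜ`; `rfl`) — either spelling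
of `Φ̄` serves at the flipped face. [folklore] -/
theorem hodgeCM_bar_eq_bar (Φ : CMType K) : HodgeCM.CMTypeOps.bar Φ = CMTypeOps.bar Φ :=
  rfl

end Summit.HodgeConjecture.CorCM.OffPlaceFace

/-! ## §2 `V` re-read at the conjugate embedding — PACKAGE side (the currency the END's stubs quantify over) -/

namespace HodgeCM.HermSpace3

open Summit.HodgeConjecture.CorCM.Model (frameOf formCongr_frameOf)
open Summit.HodgeConjecture.CorCM.Model.RecordSystemConj (conjFrame formCongr_conjFrame_starRingEnd_comp)
open Literature.AlgebraicGeometry.ShimuraVarieties (UnitaryBallUniformisationDatum.signatureMatrix_two)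
open Literature.NumberTheory.Automorphic (formCongr_star)
open Summit.HodgeConjecture.CorCM (PortJoin.HermSpace3.ofPkg)

variable {L : HodgeCM.CMField} {ι₁ : (L : Type) →+* ℂ}

/-- **`V` read at the CONJUGATE embedding `conj ∘ ι₁`, package side**: the SAME Gram matrix `V.Hm` (same hermitian space, same unitary group,
same levels, same rational frame), of signature `(2,1)` at `conj ∘ ι₁` witnessed by the conjugate `conjFrame (frameOf (PortJoin.HermSpace3.ofPkg V))` of the CorCM
Sylvester frame of record (`(V.Hm)^{conj ∘ ι₁} = conj ((V.Hm)^{ι₁})` entrywise), positive definite off the (common) place.  Fieldwise the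
CorCM-side `Summit.HodgeConjecture.CorCM.HermSpace3.alongConj (PortJoin.HermSpace3.ofPkg V)` (FILE A). [folklore] -/
def alongConj (V : HodgeCM.HermSpace3 L ι₁) : HodgeCM.HermSpace3 L ((starRingEnd ℂ).comp ι₁) where
  Hm := V.Hm
  isHermitian := V.isHermitian
  signature_ι₁ := ⟨conjFrame (frameOf (PortJoin.HermSpace3.ofPkg V)), by
    have h := formCongr_conjFrame_starRingEnd_comp V.Hm ι₁ (frameOf (PortJoin.HermSpace3.ofPkg V))
      (formCongr_frameOf (PortJoin.HermSpace3.ofPkg V))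
    rw [formCongr_star] at h
    rw [UnitaryBallUniformisationDatum.signatureMatrix_two]
    exact h⟩
  posDef_of_ne τ hτ := V.posDef_of_ne τ fun h => hτ (h.trans (InfinitePlace.mk_conjugate_eq ι₁).symm)

/-- (definitional) `V.alongConj.Hm = V.Hm`. [folklore] -/
@[simp] theorem alongConj_Hm (V : HodgeCM.HermSpace3 L ι₁) : V.alongConj.Hm = V.Hm :=
  rfl

/-- (definitional) the flipped face has the same finite-adelic unitary group `U(V)(𝔸_{L⁺,f})` — the END's `ℭ.G` is unchanged. [folklore] -/
theorem alongConj_adelicFin (V : HodgeCM.HermSpace3 L ι₁) : V.alongConj.adelicFin = V.adelicFin :=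
  rfl

/-- Positivity of `V.Hm` off the place of `conj ∘ ι₁` (= the place of `ι₁`), package side — the `hpos` input of rows I-2 ∕ I-4 at the
flipped face. [folklore] -/
theorem posDef_of_ne_starRingEnd_comp (V : HodgeCM.HermSpace3 L ι₁) :
    ∀ τ : (L : Type) →+* ℂ, InfinitePlace.mk τ ≠ InfinitePlace.mk ((starRingEnd ℂ).comp ι₁) → (V.Hm.map τ).PosDef :=
  V.alongConj.posDef_of_ne

end HodgeCM.HermSpace3

/-! ## §3 The flipped face reads the same rational frame and the same pullback hom (input of the Weil side, FILE C) -/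

namespace HodgeCM.Model

variable {L : HodgeCM.CMField} {ι₁ : (L : Type) →+* ℂ}

/-- The rational frame of record of the flipped face IS that of `V` (both are chosen from `V.Hm` alone; `rfl`). [folklore] -/
theorem frameG_alongConj (V : HodgeCM.HermSpace3 L ι₁) : frameG V.alongConj = frameG V :=
  rfl

/-- … hence the same diagonal `d` — the `dV` argument of the END's uniform Weil family `UV` is the same at both faces (`rfl`). [folklore] -/
theorem frameD_alongConj (V : HodgeCM.HermSpace3 L ι₁) : frameD V.alongConj = frameD V :=
  rfl

/-- … and the same pullback hom of record `ιVE : U(V.Hm)(𝔸_f) →* U(diagonal d)(𝔸_f)` — the `ιV` argument of `UV` is the same at both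
faces (`rfl`). [folklore] -/
theorem ιVE_alongConj (V : HodgeCM.HermSpace3 L ι₁) : ιVE V.alongConj = ιVE V :=
  rfl

end HodgeCM.Model

end
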